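import Mathlib
import Summits.Ventures.DiscreteObjects.Mahler.SubLehmerDegreeFourteen
import Summits.Ventures.DiscreteObjects.Mahler.CensusKernelDeg14Final
import Summits.Ventures.DiscreteObjects.Mahler.KernelLadderRungs
import Summits.Ventures.DiscreteObjects.Mahler.MinimalMeasureThroughDegreeTwelve

/-!
# Lehmer's conjecture for every integer polynomial of degree ≤ 15, in the kernel (venture `DiscreteObjects`, target L)

Cell `pub-namedobj`, seat `pub-namedobj-mahler-g13`. Framing: lottery ticket; floor = certified bounds/negative
ranges.

The degree-14 kernel census row `degreeCensus_fourteen` (11 cores; census search with Fejér–Riesz cuts,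
`CensusKernelDeg14A … Final`) added to `SubLehmerDegreeFourteen`:
* `minimalMeasure_degree_fourteen` — an irreducible `P` of degree `14` with `M(P) > 1` has
  `M(P) ≥ M(mrwMinimalPoly 14) = 1.2000…` (MRW Table 1, `D = 14`, now a theorem for all integer polynomials of that degree);
  `minimalMeasureByDegree_le_fourteen` — the instances `D ≤ 14` of the Literature named fact `MinimalMeasureByDegree`;
* `lehmer_le_of_irreducible_of_natDegree_le_fifteen`, `lehmer_le_of_natDegree_le_fifteen` — every `P ∈ ℤ[X]` of
  degree `≤ 15` with `M(P) > 1` has `M(P) ≥ M(ℓ)`;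
* `sixteen_le_natDegree_of_subLehmer` — `1 < M(P) < M(ℓ)` forces `deg P ≥ 16`; rungs `N ≤ 15` of the cell's sub-Lehmer
  ladder and every `HeightCell h s d` with `d ≤ 15`, unconditionally;
* `kernelCensus_le_fifteen` — the census rows at `13/10` for every degree `1 … 15`.
CONTROL rows (published complete lists reach degree 44); kernel theorems with the standard axioms.
-/

namespace Summit.Ventures.DiscreteObjects.Mahler

open Polynomial Literature.NumberTheory.MahlerMeasure

/-- **Degree 14 (MRW Table 1, D = 14):** an irreducible `P` of degree `14` with `M(P) > 1` has `M(P) ≥ M(mrwMinimalPoly 14)`. -/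
theorem minimalMeasure_degree_fourteen {P : ℤ[X]} (hirr : Irreducible P) (hdeg : P.natDegree = 14)
    (h1 : 1 < intMahlerMeasure P) : intMahlerMeasure (mrwMinimalPoly 14) ≤ intMahlerMeasure P := by
  by_cases h : intMahlerMeasure P < 13 / 10
  · obtain ⟨l, hl, hform⟩ := degreeCensus_fourteen P hdeg hirr h1 h
    rw [intMahlerMeasure_of_census_form hform]
    exact coresDeg14_min l hl
  · push Not at h
    have h14 : intMahlerMeasure (mrwMinimalPoly 14) ≤ intMahlerMeasure (ofCoeffs c14_01) :=
      coresDeg14_min c14_01 (by simp [coresDeg14])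
    exact le_trans h14 (le_trans (le_of_lt (coresDeg14_measure_bounds c14_01 (by simp [coresDeg14])).2) h)

/-- An irreducible `P` of degree `14` with `M(P) > 1` has `M(P) > 1.1883 > M(ℓ)`. -/
theorem lehmer_lt_of_irreducible_degree_fourteen {P : ℤ[X]} (hirr : Irreducible P) (hdeg : P.natDegree = 14)
    (h1 : 1 < intMahlerMeasure P) : intMahlerMeasure lehmerPoly < intMahlerMeasure P := by
  have hL : intMahlerMeasure lehmerPoly < 11883 / 10 ^ 4 := lt_trans lehmer_measure_upper_bound (by norm_num)
  by_cases h : intMahlerMeasure P < 13 / 10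
  · obtain ⟨l, hl, hform⟩ := degreeCensus_fourteen P hdeg hirr h1 h
    rw [intMahlerMeasure_of_census_form hform]
    have hne : l ≠ c10_01 := by
      rintro rfl
      simp [coresDeg14, c10_01, c14_01, c14_02, c14_03, c14_04, c14_05, c14_06, c14_07, c14_08, c14_09, c14_10,
        c14_11] at hl
    exact lt_trans hL (census_le18_gap l (by simp [hl]) hne)
  · push Not at h
    exact lt_of_lt_of_le (lt_trans hL (by norm_num)) h

/-- **Irreducible polynomials of degree `≤ 15` satisfy Lehmer's bound.** -/
theorem lehmer_le_of_irreducible_of_natDegree_le_fifteen {P : ℤ[X]} (hirr : Irreducible P)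
    (hdeg : P.natDegree ≤ 15) (h1 : 1 < intMahlerMeasure P) :
    intMahlerMeasure lehmerPoly ≤ intMahlerMeasure P := by
  by_cases h13 : P.natDegree ≤ 13
  · exact lehmer_le_of_irreducible_of_natDegree_le_thirteen hirr h13 h1
  by_cases hB : 13 / 10 ≤ intMahlerMeasure P
  · exact le_trans (le_of_lt (lt_trans lehmer_measure_upper_bound (by norm_num))) hB
  push Not at h13 hB
  have hθ : intMahlerMeasure P < smythTheta := lt_trans hB (lt_trans (by norm_num) smythTheta_gt)
  obtain ⟨-, ⟨j, hj⟩, -⟩ := reciprocal_of_measure_lt_smythTheta hirr h1 hθ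
  have hd : P.natDegree = 14 := by omega
  exact le_of_lt (lehmer_lt_of_irreducible_degree_fourteen hirr hd h1)

/-- **Lehmer's conjecture holds for every integer polynomial of degree `≤ 15`:** `M(P) > 1 ⇒ M(P) ≥ M(ℓ)`. -/
theorem lehmer_le_of_natDegree_le_fifteen {p : ℤ[X]} (hdeg : p.natDegree ≤ 15) (h1 : 1 < intMahlerMeasure p) :
    intMahlerMeasure lehmerPoly ≤ intMahlerMeasure p := by
  classical
  have hp : p ≠ 0 := by
    intro h
    rw [h] at h1
    unfold intMahlerMeasure at h1
    rw [Polynomial.map_zero, mahlerMeasure_zero] at h1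
    linarith
  obtain ⟨u, hu⟩ := UniqueFactorizationMonoid.factors_prod hp
  obtain ⟨c, hc, hcu⟩ := Polynomial.isUnit_iff.mp u.isUnit
  set F := UniqueFactorizationMonoid.factors p with hF
  have hFirr : ∀ f ∈ F, Irreducible f := fun f hf => UniqueFactorizationMonoid.irreducible_of_factor f hf
  have hMu : intMahlerMeasure (↑u : ℤ[X]) = 1 := by
    rw [← hcu, intMahlerMeasure_C]
    rcases Int.isUnit_iff.mp hc with h | h <;> simp [h]
  have hMp : intMahlerMeasure p = (F.map intMahlerMeasure).prod := by
    rw [← hu, intMahlerMeasure_mul, hMu, mul_one, intMahlerMeasure_multiset_prod]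
  have hdvd : ∀ f ∈ F, f ∣ p := fun f hf => (Multiset.dvd_prod hf).trans ⟨↑u, hu.symm⟩
  have hge1 : ∀ x ∈ F.map intMahlerMeasure, 1 ≤ x := by
    intro x hx
    obtain ⟨f, hf, rfl⟩ := Multiset.mem_map.mp hx
    exact one_le_intMahlerMeasure (hFirr f hf).ne_zero
  have hprod_ge : ∀ x ∈ F.map intMahlerMeasure, x ≤ (F.map intMahlerMeasure).prod := by
    intro x hx
    obtain ⟨T, hT⟩ := Multiset.exists_cons_of_mem hx
    rw [hT, Multiset.prod_cons]
    have hT1 : 1 ≤ T.prod :=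
      Multiset.one_le_prod (fun y hy => hge1 y (by rw [hT]; exact Multiset.mem_cons_of_mem hy))
    have hx0 : 0 ≤ x := le_trans zero_le_one (hge1 x hx)
    nlinarith
  by_contra hlt
  push Not at hlt
  have hall : ∀ x ∈ F.map intMahlerMeasure, x = 1 := by
    intro x hx
    obtain ⟨f, hf, rfl⟩ := Multiset.mem_map.mp hx
    by_contra hne
    have hgt : 1 < intMahlerMeasure f := lt_of_le_of_ne (hge1 _ hx) (Ne.symm hne)
    have hfdeg : f.natDegree ≤ 15 := (natDegree_le_of_dvd (hdvd f hf) hp).trans hdeg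
    have h2 := lehmer_le_of_irreducible_of_natDegree_le_fifteen (hFirr f hf) hfdeg hgt
    have h3 := hprod_ge _ hx
    rw [← hMp] at h3
    linarith
  have : (F.map intMahlerMeasure).prod = 1 := Multiset.prod_eq_one hall
  rw [← hMp] at this
  linarith

/-- **A sub-Lehmer polynomial has degree at least `16`.** -/
theorem sixteen_le_natDegree_of_subLehmer {P : ℤ[X]} (hP : SubLehmer P) : 16 ≤ P.natDegree := by
  by_contra h
  push Not at h
  have := lehmer_le_of_natDegree_le_fifteen (p := P) (by omega) hP.1
  exact absurd hP.2 (not_lt.mpr this)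

/-- Census rows in the engines' format, degrees `≤ 15`, below Lehmer's measure: nothing. -/
theorem heightBoundedCensus_subLehmer_of_le_fifteen {n h : ℕ} (hn : n ≤ 15) :
    HeightBoundedCensus n h (intMahlerMeasure lehmerPoly) [] := by
  refine ⟨fun p hdeg _ h1 h2 => ?_, fun l hl => by simp at hl⟩
  exfalso
  have := lehmer_le_of_natDegree_le_fifteen (p := p) (by omega) h1
  linarith

/-- **Rungs `N ≤ 15` of the sub-Lehmer ladder, unconditionally, at every height bound `h`.** -/
theorem heightSubLehmerEmptyUpTo_of_le_fifteen (h : ℕ) {N : ℕ} (hN : N ≤ 15) : HeightSubLehmerEmptyUpTo h N := by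
  intro P hdeg _ hP
  have := sixteen_le_natDegree_of_subLehmer hP
  omega

/-- Height-1 rungs `N ≤ 15`, unconditionally. -/
theorem height1SubLehmerEmptyUpTo_of_le_fifteen {N : ℕ} (hN : N ≤ 15) : Height1SubLehmerEmptyUpTo N :=
  (heightSubLehmerEmptyUpTo_one_iff N).mp (heightSubLehmerEmptyUpTo_of_le_fifteen 1 hN)

/-- Every cell `HeightCell h s d` with core degree `d ≤ 15` holds unconditionally. -/
theorem heightCell_of_le_fifteen (h : ℕ) (s : Multiset ℕ) {d : ℕ} (hd : d ≤ 15) : HeightCell h s d := by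
  intro Q hdeg _ _ _ _ _ hQ
  have := sixteen_le_natDegree_of_subLehmer hQ
  omega

/-- **`MinimalMeasureByDegree` for `D ≤ 14` (proved):** for every even `8 ≤ D ≤ 14`, an irreducible integer polynomial
of degree `D` with `M > 1` (primitive or not) has `M ≥ M(mrwMinimalPoly D)` — the `D = 8, …, 14` rows of MRW's
Theorem 1.1 / Table 1 in the Literature file's own terms. -/
theorem minimalMeasureByDegree_le_fourteen :
    ∀ D : ℕ, Even D → 8 ≤ D → D ≤ 14 →
      ∀ P : ℤ[X], Irreducible P → P.natDegree = D → 1 < (P.map (Int.castRingHom ℂ)).mahlerMeasure →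
        (∀ k : ℕ, 2 ≤ k → ∀ Q : ℤ[X], P ≠ expand ℤ k Q) →
          ((mrwMinimalPoly D).map (Int.castRingHom ℂ)).mahlerMeasure ≤ (P.map (Int.castRingHom ℂ)).mahlerMeasure := by
  intro D hD h8 h14 P hirr hdeg h1 hprim
  by_cases h12 : D ≤ 12
  · exact minimalMeasureByDegree_le_twelve D hD h8 h12 P hirr hdeg h1 hprim
  · have hD14 : D = 14 := by
      obtain ⟨k, rfl⟩ := hD; omega
    subst hD14
    exact minimalMeasure_degree_fourteen hirr hdeg h1

/-- **The kernel census of small Mahler measures, degrees `1 … 15`, bound `13/10`:** the only irreducible integer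
polynomials of degree `n ∈ [1, 15]` with `1 < M < 1.3` are, up to `±x`, the listed cores of degrees `8` (one), `10` (seven),
`12` (five) and `14` (eleven); every other degree `≤ 15` has none. -/
theorem kernelCensus_le_fifteen :
    DegreeCensus 8 (13 / 10) coresDeg8 ∧ DegreeCensus 10 (13 / 10) coresDeg10 ∧ DegreeCensus 12 (13 / 10) coresDeg12 ∧
      DegreeCensus 14 (13 / 10) coresDeg14 ∧
      ∀ n : ℕ, 1 ≤ n → n ≤ 15 → n ≠ 8 → n ≠ 10 → n ≠ 12 → n ≠ 14 → DegreeCensus n (13 / 10) [] := by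
  refine ⟨degreeCensus_eight, degreeCensus_ten, degreeCensus_twelve, degreeCensus_fourteen, ?_⟩
  intro n hn1 hn15 h8 h10 h12 h14
  have hθ : (13 : ℝ) / 10 ≤ smythTheta := le_of_lt (lt_trans (by norm_num) smythTheta_gt)
  rcases Nat.even_or_odd n with he | ho
  · have hφ : (13 : ℝ) / 10 ≤ (1 + Real.sqrt 5) / 2 := by
      have : (2 : ℝ) < Real.sqrt 5 := by
        rw [show (2 : ℝ) = Real.sqrt (2 ^ 2) by rw [Real.sqrt_sq (by norm_num)]]
        exact Real.sqrt_lt_sqrt (by norm_num) (by norm_num)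
      linarith
    obtain ⟨k, rfl⟩ := he
    rcases (by omega : k = 1 ∨ k = 2 ∨ k = 3) with rfl | rfl | rfl
    · exact degreeCensus_two_empty hφ
    · exact degreeCensus_mono (by norm_num) degreeCensus_four
    · exact degreeCensus_six
  · exact degreeCensus_odd_smythTheta ho hθ

end Summit.Ventures.DiscreteObjects.Mahler
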